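import Summits.HubbardSuperconductivity.HubbardLadder.Bounds.StiffnessFromEnergyBrackets
import Literature.MathematicalPhysics.QuantumLattice.HubbardGroundStateDoublonBound
import Literature.MathematicalPhysics.QuantumLattice.DopedRVBState
import HarnessLib

/-!
# Hubbard ladder — Bounds: strong-coupling (Mott-proximity) stiffness ceilings, part 1 —
# the hole–doublon counting route (bounds.tex Thm 7(i)–(iii), typed AND proved)

HONEST FRAMING (cell pub-hubbard): ladder R1–R4 with certified numbers; no claim on H/H₀. These
are bounds for a MODEL CLASS (the square-lattice Hubbard torus `hubbardTorus 2 L 1 U`, `t = 1`,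
`t' = 0`, every `L ≥ 3`, every filling at or below half filling, every `U`); no materials claim.
Companion text: `pub-hubbard/paper/bounds.tex` §7 (Thm 7 = SHARPENING #7, "the stiffness of a doped
Mott insulator is at most `t ×` hole density at `U = ∞`, with an explicit `U`-dependent remainder");
tables `pub-hubbard/pub-hubbard-bounds/BOUNDS.md` (row T5).

## What is proved (no `sorry`, no new axioms)

Every stiffness ceiling filed so far in `Bounds/` is either `U`-INDEPENDENT (the one-body bathtub
`4/π² = 0.405 t` and its `t'`, thermal and gauge variants) or a hook consuming certified energy
brackets at isolated `(U, n)` (`StiffnessCeilingFromEnergyBrackets`). This file adds the first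
ceilings that DECAY with `U` at fixed hole density, from three tree ingredients only: the f-sum /
trial-twist floor `ρ_s L² ≤ K_x(ψ)` (`stiffness_mul_sq_le_sum_re_hop_of_isGroundStateInSector`), the
hole–doublon COUNTING bound on the hopping form (`holeCounting_le_re_expect_hamiltonian`, at `U = 0`:
`2(K_x + K_y)(φ) ≤ 4((L² - N) + ω L² + (2 + 2/ω) D(φ))` for every `ω > 0`), and the joint-sector CHORD
inequality `(U - U₁) D(ψ_U) ≤ E(U) - E(U₁)` (`sectorEnergy_le_add_mul_doubleOccExp`).

* `HoleDoublonStiffnessCeiling` (`@[conjecture] def`, PROVED by `…_holds`) — bracket form, every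
  filling `δ ≥ -1`, every `U₁ < U`, every `ω > 0`:
  `ρ_s L² ≤ (L² - N_L) + ω L² + (2 + 2ω⁻¹)(R - L₁)/(U - U₁)` from brackets `E_L(U) ≤ R`,
  `L₁ ≤ E_L(U₁)` of the `(N_L, S^z = 0)` sector energies (`N_L = 2⌊(1-δ)L²/2⌋`).
* `StrongCouplingStiffnessCeiling` (PROVED) — closed form at or below half filling (`δ ≥ 0`), every
  `8 < U₁ < U`, `ω > 0`, with `n_h = (L² - N_L)/L²` the hole density of the sector:
  `ρ_s ≤ n_h + ω + (2 + 2ω⁻¹)(4 n_h + 32/(U₁ - 8))/(U - U₁)`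
  (`R = 0` from `minEnergyOn_szSector_hubbardTorus_le_zero`; `L₁ = -4(L² - N_L) - 32L²/(U₁ - 8)` =
  the tree's hole-counting floor `hubbardTorus_holeCounting_floor` at `ω₁ = 8/(U₁ - 8)`).
* `StrongCouplingStiffnessCeilingTL` (PROVED) — the same for a stiffness constant valid along all
  large even tori (the cell's thermodynamic-limit convention, `StiffnessFromEnergyBracketsTL`):
  `ρ_s ≤ δ + ω + (2 + 2ω⁻¹)(4δ + 32/(U₁ - 8))/(U - U₁)` for `0 ≤ δ`.
* `InfiniteUStiffnessLimsup` (PROVED) — **`limsup_{U → ∞} ρ_s ≤ t · n_h` uniformly in `L ≥ 3` and in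
  the filling**: `∀ ε > 0 ∃ U₀ ∀ L ≥ 3 ∀ U ≥ U₀ ∀ δ ≥ 0`, every flux stiffness `ρ_s` of the
  `(N_L, S^z = 0)` sector obeys `ρ_s ≤ n_h + ε` (`U₀ = 41 + 10(2 + 4/ε)/ε` works).

NUMBERS (honest): the leading term `n_h · t` is the Nagaoka/`t–J` kinetic scale (each hole carries at
most `z t = 4t` of hopping energy, and `ρ_s L² ≤ ⟨-T⟩/4`); it is the rigorous, model-class form of the
"`T_c ∝` doping near the Mott insulator" bound of Hazra–Verma–Randeria (PRX 2019, §III and Fig. 2,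
there heuristic / numerical). The remainder is LOOSE: optimised over `(ω, U₁)` it is
`2√(2 d̄) + 2 d̄` with `d̄ = min_{U₁} (4 n_h + 32/(U₁ - 8))/(U - U₁)` (`= 128/(U - 8)²` at `n_h = 0`),
i.e. `≈ 32 t/U` at `n_h = 0`: at `n_h = 0.1` the ceiling is below the one-body `4/π²` only for
`U ≳ 160 t`, and at half filling only for `U ≳ 95 t` (the companion file `MottStiffnessCeiling.lean`
does `≈ 8 t²/U` there from Langer–Mattis + SDW brackets, below `4/π²` from `U ≈ 17 t`). The CONTENT of
this file is the asymptotic statement `InfiniteUStiffnessLimsup` and the bracket node, which improves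
monotonically with any certified doped-sector energy brackets (R1).

Nearest prior art (non-rigorous for the Hubbard ground state): ParamekantiRanderiaTrivedi2001
(`D_s ≤ D_low`, `D_low(x) → 0` linearly for Gutzwiller-PROJECTED states); HazraVermaRanderia2019 §III.
References (keys of `lean/references.bib`): HazraVermaRanderia2019 §III, App. G;
ParamekantiTrivediRanderia1998 eq. (3); ParamekantiRanderiaTrivedi2001; KomaTasaki1994 §1;
Nagaoka1966; LiebPRL1989.
-/

noncomputable section

namespace Summit.HubbardSuperconductivity.HubbardLadder.Bounds

open Matrix Finset Real Filter Topology
open Literature.MathematicalPhysics.QuantumLattice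
open Literature.MathematicalPhysics.QuantumFieldTheory
open Literature.Probability.LatticeModels
open Literature.MathematicalPhysics.QuantumLattice.ThermodynamicLimit
open scoped ComplexOrder ComplexConjugate Topology

variable {L : ℕ} [NeZero L]

/-! ### The hole–doublon counting bound on the kinetic weight -/

/-- **Counting bound** (the tree's `holeCounting_le_re_expect_hamiltonian` at `t = 1`, `U = 0`): for an
`N`-particle unit vector `φ` on the `L × L` torus (`L ≥ 3`) and every `ω > 0`,
`2(K_x + K_y)(φ) ≤ 4((L² - N) + ω L² + (2 + 2ω⁻¹) D(φ))`. -/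
theorem two_mul_kinWeight_le_holeDoublon (hL : 3 ≤ L) {ω : ℝ} (hω : 0 < ω) {N : ℕ}
    {φ : Fock (Orb (FermionTorus 2 L))} (hN : IsNParticle N φ) (h1 : star φ ⬝ᵥ φ = 1) :
    2 * (kinWeightDir 0 φ + kinWeightDir 1 φ) ≤
      4 * (((L : ℝ) ^ 2 - N) + ω * (L : ℝ) ^ 2 + (2 + 2 * ω⁻¹) * doubleOccExp φ) := by
  have hΔ : ∀ v : FermionTorus 2 L,
      (Finset.univ.filter ((fermionTorusGraph 2 L).Adj v)).card ≤ 4 := fun v =>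
    card_filter_fermionTorusGraph_adj_le v
  have h := holeCounting_le_re_expect_hamiltonian (fermionTorusGraph 2 L) hΔ 1 0 hω hN h1
  have hcard : Fintype.card (FermionTorus 2 L) = L ^ 2 := by simp [FermionTorus, Fintype.card_lex]
  have hkin : (star φ ⬝ᵥ (hamiltonian (fermionTorusGraph 2 L) 1 0 *ᵥ φ)).re =
      -(2 * (kinWeightDir 0 φ + kinWeightDir 1 φ)) := re_expect_hubbardTorus_zero_eq_kin hL φ
  have hD : (star φ ⬝ᵥ ((∑ x : FermionTorus 2 L, numberOp x 0 * numberOp x 1) *ᵥ φ)).re =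
      doubleOccExp φ := rfl
  rw [hcard, hkin, hD, abs_one] at h
  push_cast at h
  linarith

/-! ### Particle number bookkeeping -/

/-- The hole density of the `(N_L, S^z = 0)` sector at nominal filling `1 - δ`:
`n_h = (L² - N_L)/L²`, `N_L = rectN (1-δ) L = 2⌊(1-δ)L²/2⌋`. -/
def holeDensity (L : ℕ) (δ : ℝ) : ℝ := ((L : ℝ) ^ 2 - (rectN (1 - δ) L : ℕ)) / (L : ℝ) ^ 2

-- `rectN_one_sub_le_sq` (N_L ≤ L² for δ ≥ 0) is the landed
-- `Literature.MathematicalPhysics.QuantumLattice.two_mul_natFloor_le_sq` (DopedRVBState.lean);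
-- reused below instead of restated (gate dedup.landed, lit g5 filing edit; statements of all nodes unchanged).

/-- `0 ≤ n_h ≤ 1` at or below half filling, and `n_h ≤ δ + 2/L²`. -/
theorem holeDensity_bounds {δ : ℝ} (hδ : 0 ≤ δ) (L : ℕ) [NeZero L] :
    0 ≤ holeDensity L δ ∧ holeDensity L δ ≤ 1 ∧ holeDensity L δ ≤ δ + 2 / (L : ℝ) ^ 2 := by
  have hL : (0 : ℝ) < (L : ℝ) ^ 2 := by have := NeZero.pos L; positivity
  have hN : ((rectN (1 - δ) L : ℕ) : ℝ) ≤ (L : ℝ) ^ 2 := by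
    have := two_mul_natFloor_le_sq hδ L; rw [rectN]; exact_mod_cast this
  have hN0 : (0 : ℝ) ≤ (rectN (1 - δ) L : ℕ) := Nat.cast_nonneg _
  have hlt := lt_rectN_add_two (1 - δ) L
  refine ⟨div_nonneg (sub_nonneg.2 hN) hL.le, ?_, ?_⟩
  · rw [holeDensity, div_le_one hL]; linarith
  · have key : (δ + 2 / (L : ℝ) ^ 2) * (L : ℝ) ^ 2 = δ * (L : ℝ) ^ 2 + 2 := by
      rw [add_mul, div_mul_cancel₀ _ hL.ne']
    rw [holeDensity, div_le_iff₀ hL, key]; linarith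

/-! ### Node 1 — bracket form (bounds.tex Thm 7(i)) -/

/-- **Thm 7(i) (hole–doublon stiffness ceiling from energy brackets).** `L ≥ 3`, `δ ≥ -1`, `U₁ < U`,
`ω > 0`; `ρ_s > 0` a flux stiffness of the `(N_L, S^z = 0)` sector of `hubbardTorus 2 L 1 U`
(`ρ_s θ² ≤ E(θ) - E(0)` for `|θ| ≤ θ₀`); brackets `E_L(U) ≤ R`, `L₁ ≤ E_L(U₁)`. Then
`ρ_s L² ≤ (L² - N_L) + ω L² + (2 + 2ω⁻¹)(R - L₁)/(U - U₁)`.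
kind: support (PROVED below). Why it might fail: it cannot; it is loose when `D(ψ)` is (the `ω`-trade
costs `√D`). Sources: HazraVermaRanderia2019 §III; KomaTasaki1994 §1; this cell (counting bound). -/
@[conjecture] def HoleDoublonStiffnessCeiling : Prop :=
  ∀ (L : ℕ) [NeZero L], 3 ≤ L → ∀ (U U₁ δ ρs θ₀ ω : ℝ), -1 ≤ δ → U₁ < U → 0 < ρs → 0 < θ₀ → 0 < ω →
    (∀ θ : ℝ, |θ| ≤ θ₀ → ρs * θ ^ 2 ≤ fluxEnergy L U δ θ - fluxEnergy L U δ 0) →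
    ∀ (R L₁ : ℝ), fluxEnergy L U δ 0 ≤ R → L₁ ≤ fluxEnergy L U₁ δ 0 →
      ρs * (L : ℝ) ^ 2 ≤ ((L : ℝ) ^ 2 - (rectN (1 - δ) L : ℕ)) + ω * (L : ℝ) ^ 2 +
        (2 + 2 * ω⁻¹) * ((R - L₁) / (U - U₁))

/-- **Proof of `HoleDoublonStiffnessCeiling`**: f-sum floor on a unit ground state `ψ` and on its
rotation `Γ(r)ψ` (`K_y(Γψ) = K_x(ψ)`), the counting bound for `Γ(r)ψ`, and the chord bound on `D`. -/
theorem holeDoublonStiffnessCeiling_holds : HoleDoublonStiffnessCeiling := by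
  intro L _ hL U U₁ δ ρs θ₀ ω hδ hU₁ hρs hθ₀ hω hst R L₁ hR hL₁
  obtain ⟨ψ, h1, hgs⟩ := NoGo.exists_unit_groundStateInSector_hubbardTorus L 1 U
    (NoGo.floor_pairNumber_le δ hδ L)
  set φ : Fock (Orb (FermionTorus 2 L)) :=
    fockMapOp (d4Orb (DihedralGroup.r 1 : DihedralGroup 4)) *ᵥ ψ with hφ_def
  have hφgs : IsGroundStateInSector (hubbardTorus 2 L 1 U) (2 * ⌊(1 - δ) * (L : ℝ) ^ 2 / 2⌋₊) 0 φ :=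
    hgs.fockMapOp_d4Orb_mulVec _
  have hφ1 : star φ ⬝ᵥ φ = 1 := by
    rw [hφ_def, star_fockMapOp_mulVec_dotProduct_self _ (d4Orb_bijective _).injective, h1]
  have hKy : kinWeightDir 1 φ = kinWeightDir 0 ψ := kinWeightDir_one_rot ψ
  have hfψ : ρs * (L : ℝ) ^ 2 ≤ kinWeightDir 0 ψ :=
    (stiffness_mul_sq_le_sum_re_hop_of_isGroundStateInSector hL U δ hρs hθ₀ hst hgs h1).trans_eq
      (kinWeightX_eq_kinWeightDir ψ)
  have hfφ : ρs * (L : ℝ) ^ 2 ≤ kinWeightDir 0 φ :=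
    (stiffness_mul_sq_le_sum_re_hop_of_isGroundStateInSector hL U δ hρs hθ₀ hst hφgs hφ1).trans_eq
      (kinWeightX_eq_kinWeightDir φ)
  -- the counting bound for `φ`
  have hN : IsNParticle (2 * ⌊(1 - δ) * (L : ℝ) ^ 2 / 2⌋₊) φ := ((mem_szSector_iff _ _ φ).1 hφgs.1).1
  have hcount := two_mul_kinWeight_le_holeDoublon hL hω hN hφ1
  -- the chord bound on `D(φ)`
  have hchord := sectorEnergy_le_add_mul_doubleOccExp hφgs hφ1 U₁
  rw [fluxEnergy_zero_eq_sectorEnergy (L := L) U δ] at hR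
  rw [fluxEnergy_zero_eq_sectorEnergy (L := L) U₁ δ] at hL₁
  have hUU : 0 < U - U₁ := sub_pos.2 hU₁
  have hD : doubleOccExp φ ≤ (R - L₁) / (U - U₁) := by
    rw [le_div_iff₀ hUU]; linarith
  have hω2 : (0 : ℝ) ≤ 2 + 2 * ω⁻¹ := by positivity
  have hcD := mul_le_mul_of_nonneg_left hD hω2
  have hrect : ((rectN (1 - δ) L : ℕ) : ℝ) = ((2 * ⌊(1 - δ) * (L : ℝ) ^ 2 / 2⌋₊ : ℕ) : ℝ) := by
    rw [rectN]
  rw [hrect]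
  linarith

/-! ### Node 2 — closed form at or below half filling (bounds.tex Thm 7(ii)) -/

/-- Arithmetic: divide the finite-volume ceiling by `L² > 0`. -/
private theorem div_sq_form {ρ S h ω c q W : ℝ} (hS : 0 < S) (hW : W ≠ 0)
    (H : ρ * S ≤ h + ω * S + c * ((4 * h + q * S) / W)) :
    ρ ≤ h / S + ω + c * ((4 * (h / S) + q) / W) := by
  have key : (h / S + ω + c * ((4 * (h / S) + q) / W)) * S = h + ω * S + c * ((4 * h + q * S) / W) := by
    field_simp
  exact le_of_mul_le_mul_right (H.trans_eq key.symm) hS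

/-- **Thm 7(ii) (strong-coupling stiffness ceiling, closed form).** `L ≥ 3`, `0 ≤ δ` (at or below
half filling), `8 < U₁ < U`, `ω > 0`, `ρ_s > 0` a flux stiffness of the `(N_L, S^z = 0)` sector of
`hubbardTorus 2 L 1 U`. Then, with `n_h = holeDensity L δ = (L² - N_L)/L²`,
`ρ_s ≤ n_h + ω + (2 + 2ω⁻¹)(4 n_h + 32/(U₁ - 8))/(U - U₁)`.
kind: support (PROVED below). Why it might fail: it cannot; numerically it beats the one-body `4/π²`
only for `U ≳ 85 t` (`n_h = 0`) resp. `U ≳ 150 t` (`n_h = 0.1`). Sources: HazraVermaRanderia2019 §III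
(doped Mott insulator, `D̃ ∝ x`); Nagaoka1966; this cell. -/
@[conjecture] def StrongCouplingStiffnessCeiling : Prop :=
  ∀ (L : ℕ) [NeZero L], 3 ≤ L → ∀ (U U₁ δ ρs θ₀ ω : ℝ), 0 ≤ δ → 8 < U₁ → U₁ < U → 0 < ρs →
    0 < θ₀ → 0 < ω → (∀ θ : ℝ, |θ| ≤ θ₀ → ρs * θ ^ 2 ≤ fluxEnergy L U δ θ - fluxEnergy L U δ 0) →
      ρs ≤ holeDensity L δ + ω + (2 + 2 * ω⁻¹) * ((4 * holeDensity L δ + 32 / (U₁ - 8)) / (U - U₁))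

/-- **Proof of `StrongCouplingStiffnessCeiling`** from `HoleDoublonStiffnessCeiling` with `R = 0`
(`minEnergyOn_szSector_hubbardTorus_le_zero`) and `L₁ =` the hole-counting floor at `U₁` with
`ω₁ = 8/(U₁ - 8)` (`hubbardTorus_holeCounting_floor`). -/
theorem strongCouplingStiffnessCeiling_holds : StrongCouplingStiffnessCeiling := by
  intro L _ hL U U₁ δ ρs θ₀ ω hδ hU₁8 hU₁ hρs hθ₀ hω hst
  have hδ' : (-1 : ℝ) ≤ δ := by linarith
  have hL2 : (0 : ℝ) < (L : ℝ) ^ 2 := by have := NeZero.pos L; positivity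
  -- `R = 0`
  have hR : fluxEnergy L U δ 0 ≤ 0 := by
    rw [fluxEnergy_zero_eq_sectorEnergy]
    exact minEnergyOn_szSector_hubbardTorus_le_zero (L := L) U (two_mul_natFloor_le_sq hδ L)
  -- `L₁` = hole-counting floor at `U₁`, `ω₁ = 8/(U₁ - 8)`
  set ω₁ : ℝ := 8 / (U₁ - 8) with hω₁_def
  have hU₁8' : 0 < U₁ - 8 := sub_pos.2 hU₁8
  have hω₁ : 0 < ω₁ := div_pos (by norm_num) hU₁8'
  have hU₁eq : 8 + 8 * ω₁⁻¹ ≤ U₁ := by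
    rw [hω₁_def, inv_div]
    have : 8 + 8 * ((U₁ - 8) / 8) = U₁ := by ring
    exact this.le
  obtain ⟨ψ₁, h1, hgs₁⟩ := NoGo.exists_unit_groundStateInSector_hubbardTorus L 1 U₁
    (NoGo.floor_pairNumber_le δ hδ' L)
  have hL₁ : -(4 * ((L : ℝ) ^ 2 - (2 * ⌊(1 - δ) * (L : ℝ) ^ 2 / 2⌋₊ : ℕ)) + 4 * ω₁ * (L : ℝ) ^ 2) ≤
      fluxEnergy L U₁ δ 0 := by
    rw [fluxEnergy_zero_eq_sectorEnergy]
    exact hubbardTorus_holeCounting_floor hω₁ hU₁eq _ 0 ⟨ψ₁, hgs₁.1, h1⟩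
  have h := holeDoublonStiffnessCeiling_holds L hL U U₁ δ ρs θ₀ ω hδ' hU₁ hρs hθ₀ hω hst 0 _ hR hL₁
  have hrect : ((rectN (1 - δ) L : ℕ) : ℝ) = ((2 * ⌊(1 - δ) * (L : ℝ) ^ 2 / 2⌋₊ : ℕ) : ℝ) := by
    rw [rectN]
  rw [← hrect] at h
  have h4 : 4 * ω₁ = 32 / (U₁ - 8) := by rw [hω₁_def]; ring
  simp only [sub_neg_eq_add, zero_add] at h
  rw [h4] at h
  exact div_sq_form hL2 (sub_pos.2 hU₁).ne' h

/-! ### Node 3 — thermodynamic-limit form (bounds.tex Thm 7(iii)) -/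

/-- A bound `ρ ≤ A + B/L²` along all large even `L` gives `ρ ≤ A`. -/
private theorem le_of_forall_even_sq {ρ A B : ℝ} (L₀ : ℕ)
    (h : ∀ L : ℕ, L₀ ≤ L → 3 ≤ L → Even L → ρ ≤ A + B / (L : ℝ) ^ 2) : ρ ≤ A := by
  refine le_of_forall_pos_lt_add fun ε hε => ?_
  obtain ⟨m, hm⟩ := exists_nat_gt (B / ε)
  set L : ℕ := 2 * (m + L₀ + 3) with hLdef
  have hL1 : (1 : ℝ) ≤ L := by rw [hLdef]; push_cast; linarith [(Nat.cast_nonneg m : (0:ℝ) ≤ m),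
    (Nat.cast_nonneg L₀ : (0:ℝ) ≤ L₀)]
  have hmL : (m : ℝ) ≤ (L : ℝ) ^ 2 := by
    have : (m : ℝ) ≤ L := by rw [hLdef]; push_cast; linarith [(Nat.cast_nonneg L₀ : (0:ℝ) ≤ L₀)]
    nlinarith
  have hL2 : (0 : ℝ) < (L : ℝ) ^ 2 := by positivity
  have hBL : B / (L : ℝ) ^ 2 < ε := by
    rw [div_lt_iff₀ hL2]
    rw [div_lt_iff₀ hε] at hm
    nlinarith
  have := h L (by omega) (by omega) ⟨m + L₀ + 3, by omega⟩
  linarith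

/-- **Thm 7(iii) (strong-coupling stiffness ceiling, thermodynamic limit).** If `ρ_s > 0` is a flux
stiffness of the `(N_L, S^z = 0)` sectors of `hubbardTorus 2 L 1 U` for all large even `L` (same
`ρ_s, θ₀`), `0 ≤ δ`, `8 < U₁ < U`, `ω > 0`, then `ρ_s ≤ δ + ω + (2 + 2ω⁻¹)(4δ + 32/(U₁ - 8))/(U - U₁)`.
kind: support (PROVED below). Why it might fail: it cannot. Sources: HazraVermaRanderia2019 §III;
this cell. -/
@[conjecture] def StrongCouplingStiffnessCeilingTL : Prop :=
  ∀ (U U₁ δ ρs θ₀ ω : ℝ) (L₀ : ℕ), 0 ≤ δ → 8 < U₁ → U₁ < U → 0 < ρs → 0 < θ₀ → 0 < ω →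
    (∀ (L : ℕ) [NeZero L], L₀ ≤ L → Even L →
      ∀ θ : ℝ, |θ| ≤ θ₀ → ρs * θ ^ 2 ≤ fluxEnergy L U δ θ - fluxEnergy L U δ 0) →
    ρs ≤ δ + ω + (2 + 2 * ω⁻¹) * ((4 * δ + 32 / (U₁ - 8)) / (U - U₁))

/-- **Proof of `StrongCouplingStiffnessCeilingTL`**: Thm 7(ii) at every large even `L` with
`n_h ≤ δ + 2/L²`, then `L → ∞`. -/
theorem strongCouplingStiffnessCeilingTL_holds : StrongCouplingStiffnessCeilingTL := by
  intro U U₁ δ ρs θ₀ ω L₀ hδ hU₁8 hU₁ hρs hθ₀ hω hst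
  set c : ℝ := 2 + 2 * ω⁻¹ with hc_def
  have hc : 0 ≤ c := by positivity
  have hW : 0 < U - U₁ := sub_pos.2 hU₁
  have hq : 0 ≤ 32 / (U₁ - 8) := div_nonneg (by norm_num) (sub_pos.2 hU₁8).le
  refine le_of_forall_even_sq (B := 2 * (1 + c * (4 / (U - U₁)))) L₀ fun L hL₀ hL3 hLe => ?_
  haveI : NeZero L := ⟨by omega⟩
  have h := strongCouplingStiffnessCeiling_holds L hL3 U U₁ δ ρs θ₀ ω hδ hU₁8 hU₁ hρs hθ₀ hω
    (hst L hL₀ hLe)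
  obtain ⟨-, -, hnh⟩ := holeDensity_bounds hδ L
  have hL2 : (0 : ℝ) < (L : ℝ) ^ 2 := by positivity
  have hmono : c * ((4 * holeDensity L δ + 32 / (U₁ - 8)) / (U - U₁)) ≤
      c * ((4 * (δ + 2 / (L : ℝ) ^ 2) + 32 / (U₁ - 8)) / (U - U₁)) :=
    mul_le_mul_of_nonneg_left (div_le_div_of_nonneg_right (by linarith) hW.le) hc
  have key : δ + 2 / (L : ℝ) ^ 2 + ω + c * ((4 * (δ + 2 / (L : ℝ) ^ 2) + 32 / (U₁ - 8)) / (U - U₁)) =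
      δ + ω + c * ((4 * δ + 32 / (U₁ - 8)) / (U - U₁)) + 2 * (1 + c * (4 / (U - U₁))) / (L : ℝ) ^ 2 := by
    field_simp
    ring
  linarith

/-! ### Node 4 — the `U → ∞` asymptotics (bounds.tex Thm 7(iv)) -/

/-- **Thm 7(iv) (`limsup_{U→∞} ρ_s ≤ t n_h`, uniformly in the volume and the filling).** For every
`ε > 0` there is `U₀` (e.g. `41 + 10(2 + 4/ε)/ε`) such that for all `L ≥ 3`, `U ≥ U₀`, `δ ≥ 0`, every
flux stiffness `ρ_s > 0` of the `(N_L, S^z = 0)` sector of `hubbardTorus 2 L 1 U` satisfies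
`ρ_s ≤ n_h + ε`, `n_h = (L² - N_L)/L²`: at `U = ∞` the stiffness is at most `t ×` hole density.
kind: support (PROVED below). Why it might fail: it cannot. Sources: Nagaoka1966;
HazraVermaRanderia2019 §III; this cell. -/
@[conjecture] def InfiniteUStiffnessLimsup : Prop :=
  ∀ ε : ℝ, 0 < ε → ∃ U₀ : ℝ, ∀ (L : ℕ) [NeZero L], 3 ≤ L → ∀ (U δ ρs θ₀ : ℝ), U₀ ≤ U → 0 ≤ δ →
    0 < ρs → 0 < θ₀ → (∀ θ : ℝ, |θ| ≤ θ₀ → ρs * θ ^ 2 ≤ fluxEnergy L U δ θ - fluxEnergy L U δ 0) →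
      ρs ≤ holeDensity L δ + ε

/-- **Proof of `InfiniteUStiffnessLimsup`**: Thm 7(ii) with `ω = ε/2`, `U₁ = 40` and
`U ≥ 41 + 10(2 + 4/ε)/ε`, using `0 ≤ n_h ≤ 1`. -/
theorem infiniteUStiffnessLimsup_holds : InfiniteUStiffnessLimsup := by
  intro ε hε
  set c : ℝ := 2 + 2 * (ε / 2)⁻¹ with hc_def
  have hc : 0 < c := by positivity
  refine ⟨41 + 10 * c / ε, fun L _ hL U δ ρs θ₀ hU hδ hρs hθ₀ hst => ?_⟩
  have hω : (0 : ℝ) < ε / 2 := by positivity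
  have hU₁ : (40 : ℝ) < U := by
    have : 0 < 10 * c / ε := by positivity
    linarith
  have h := strongCouplingStiffnessCeiling_holds L hL U 40 δ ρs θ₀ (ε / 2) hδ (by norm_num) hU₁ hρs
    hθ₀ hω hst
  obtain ⟨h0, h1, -⟩ := holeDensity_bounds hδ L
  have hW : 0 < U - 40 := by linarith
  -- the remainder is at most `c · 5/(U - 40) ≤ ε/2`
  have hnum : 4 * holeDensity L δ + 32 / (40 - 8) ≤ 5 := by norm_num; linarith
  have hrem : c * ((4 * holeDensity L δ + 32 / (40 - 8)) / (U - 40)) ≤ c * (5 / (U - 40)) :=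
    mul_le_mul_of_nonneg_left (div_le_div_of_nonneg_right hnum hW.le) hc.le
  have hfin : c * (5 / (U - 40)) ≤ ε / 2 := by
    rw [← mul_div_assoc, div_le_iff₀ hW]
    have hU' : 10 * c / ε ≤ U - 41 := by linarith
    rw [div_le_iff₀ hε] at hU'
    nlinarith
  rw [← hc_def] at h
  linarith

end Summit.HubbardSuperconductivity.HubbardLadder.Bounds

end
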